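import Summits.BirchSwinnertonDyer.BirchSwinnertonDyer.Theorems.AlignedTransportAtTwoMainConjectureOfRankZeroBSDAtTwoEisensteinRigidityPrime
import Mathlib.RingTheory.Polynomial.GaussLemma
import Mathlib.Algebra.Polynomial.SpecificDegree
import HarnessLib

/-!
# Route `AlignedTransportAtTwo`, crux C2 `MainConjectureOfRankZeroBSDAtTwo` (stmt-BirchSwinnertonDyer-22298):
# THE `ℚ_p`-DICTIONARY FOR PRIME CERTIFICATES IN `Λ = ℤ_p⟦T⟧` — `g` prime ⟺ its Weierstrass polynomial is IRREDUCIBLE OVER `ℚ_p` (Gauss), and for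
# Weierstrass degree `λ(g) ∈ {2, 3}`: `g` prime ⟸ NO ROOT, i.e. no linear factor `T − r`, `‖r‖ < 1`, divides `g`

HONEST FRAMING (cell `bsd-f1-sign2`, WIDTH-5 attached prover seat `bsd-line-att-p5` gen 35 on line `birth` of the lead
`bsd-line-att-p2`; `--supports` stmt-BirchSwinnertonDyer-22298, closes nothing; BSD is NOT proved by any of this; the crux C2, its
verdict «blocked-on `Rank1Residual.GreenbergMuConjectureIrreducible`» and every registered stub are untouched). PURE COMMUTATIVE
ALGEBRA over `Λ = ℤ_p⟦T⟧` — THEOREMS ONLY (no `def`, no named fact, no `sorry`). Sequel of this seat's `…EisensteinRigidityPrime` (§1 there: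
`Prime g ⟺ Prime P` for a Weierstrass factorisation `g = P·u`). This file is the -data face of the conservation law
(`…EisensteinRigidityPrimeRoad`, `…PrimeRoadRows`, `…PrimeFactors`): the certificate «`Q` prime in `Λ`» for a factor `Q` of the integral `2`-adic
`L`-function is EXACTLY «the Weierstrass polynomial of `Q` is irreducible over `ℚ₂`» (what `factorpadic` answers), and in Weierstrass degree `2` or `3`
it is «no `2`-adic root in the open unit disc».

* §1 ★ `prime_iff_irreducible_map_of_isWeierstrassFactorization` — **`g = P·u` is prime in `Λ` ⟺ `P` is irreducible in `ℚ_p[X]`** (Mathlib's Gauss lemma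
  `Monic.irreducible_iff_irreducible_map_fraction_map` for the integrally closed `ℤ_p`, and irreducible ⟺ prime in the UFD `ℤ_p[X]`).
* §2 `norm_lt_one_of_isRoot_of_isDistinguishedAt` — a root `r ∈ ℤ_p` of a distinguished polynomial lies in `pℤ_p`;
  `coe_X_sub_C_dvd_of_isRoot` — it gives a linear factor `T − r ∣ g` in `Λ`.
* §3 ★ `prime_of_isWeierstrassFactorization_of_forall_not_isRoot` — **Weierstrass degree `2 ≤ deg P ≤ 3` and `P` has no root in `ℤ_p` ⇒ `g` prime**
  (Mathlib `Monic.irreducible_iff_roots_eq_zero_of_degree_le_three`); ★★ `prime_of_lam_le_three_of_forall_not_dvd` — the intrinsic form: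
  **`g ≢ 0 (mod p)`, `2 ≤ λ(g) ≤ 3`, and NO linear factor `T − r` (`‖r‖ < 1`) divides `g` ⇒ `g` is prime in `Λ`**. For the `ι`-pair factor `Q` of
  `…PrimeRoadRows` (`λ(Q) = 2`): `Prime Q` ⟺ the pair is `ℚ₂`-irrational ⟺ `L₂(W,T)` has no zero `T = r ∈ 2ℤ₂` besides `−2` on that segment.

References: L. Washington, GTM 83, §7.1, §13.2 [Washington1997]; S. Lang, Cyclotomic Fields I–II, Ch. 5 §2 [Lang1990]; R. Greenberg, LNM 1716
(1999), §5 pp. 176–182 [GreenbergLNM1716].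
-/

set_option linter.dupNamespace false
set_option autoImplicit false

noncomputable section

open scoped Classical Polynomial

namespace Summit.BirchSwinnertonDyer.BirchSwinnertonDyer.Theorems.AlignedTransportAtTwoEisensteinRigidityPrimeLowDegree

open PowerSeries Literature.NumberTheory.EllipticCurves
  Summit.BirchSwinnertonDyer.Rank1Residual.X1.MuLambda
  Summit.BirchSwinnertonDyer.BirchSwinnertonDyer.Theorems.AlignedTransportAtTwoTwoFixedPoints
  Summit.BirchSwinnertonDyer.BirchSwinnertonDyer.Theorems.AlignedTransportAtTwoEisensteinRigidity
  Summit.BirchSwinnertonDyer.BirchSwinnertonDyer.Theorems.AlignedTransportAtTwoEisensteinRigidityPrime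

variable {p : ℕ} [Fact p.Prime]

/-! ## §1 Gauss: prime in `Λ` ⟺ Weierstrass polynomial irreducible over `ℚ_p` -/

/-- ★ **`g = P·u` (Weierstrass factorisation) is PRIME in `Λ = ℤ_p⟦T⟧` iff `P` is IRREDUCIBLE in `ℚ_p[X]`.** (`…Prime` §1: `Prime g ⟺ Prime P` in `ℤ_p[X]`;
`ℤ_p[X]` is a UFD so prime ⟺ irreducible; Gauss's lemma for the monic `P` over the integrally closed `ℤ_p`.) This is the -data certificate: factor the
Weierstrass polynomial `p`-adically. [cite: Washington1997, §7.1 and §13.2] [cite: Lang1990, Ch. 5 §2] -/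
theorem prime_iff_irreducible_map_of_isWeierstrassFactorization {g u : PowerSeries ℤ_[p]} {P : ℤ_[p][X]}
    (H : g.IsWeierstrassFactorization P u) : Prime g ↔ Irreducible (P.map (algebraMap ℤ_[p] ℚ_[p])) := by
  rw [prime_iff_of_isWeierstrassFactorization H, ← UniqueFactorizationMonoid.irreducible_iff_prime,
    H.isDistinguishedAt.monic.irreducible_iff_irreducible_map_fraction_map (K := ℚ_[p])]

/-- The same for Mathlib's chosen Weierstrass polynomial: `g ≢ 0 (mod p)` is prime in `Λ` iff `weierstrassDistinguished g` is irreducible over `ℚ_p`.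
[cite: Washington1997, §7.1 and §13.2] -/
theorem prime_iff_irreducible_map_weierstrassDistinguished {g : PowerSeries ℤ_[p]} (hg : g.map (IsLocalRing.residue ℤ_[p]) ≠ 0) :
    Prime g ↔ Irreducible ((g.weierstrassDistinguished hg).map (algebraMap ℤ_[p] ℚ_[p])) :=
  prime_iff_irreducible_map_of_isWeierstrassFactorization (g.isWeierstrassFactorization_weierstrassDistinguished_weierstrassUnit hg)

/-! ## §2 Roots of distinguished polynomials lie in `pℤ_p` and give linear factors in `Λ` -/

/-- **A root `r ∈ ℤ_p` of a distinguished polynomial has `‖r‖ < 1`**: `r^n = −Σ_{i<n} cᵢ rⁱ ∈ 𝔪` with all `cᵢ ∈ 𝔪`, and `𝔪` is prime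
(degree `0` is vacuous: `P = 1` has no root).
[cite: Washington1997, §7.1] -/
theorem norm_lt_one_of_isRoot_of_isDistinguishedAt {P : ℤ_[p][X]} (hP : P.IsDistinguishedAt (IsLocalRing.maximalIdeal ℤ_[p]))
    {r : ℤ_[p]} (hr : P.IsRoot r) : ‖r‖ < 1 := by
  set n := P.natDegree with hn_def
  -- `P(r) = r^n + Σ_{i<n} cᵢ rⁱ = 0`
  have heval : P.eval r = ∑ i ∈ Finset.range (n + 1), P.coeff i * r ^ i := Polynomial.eval_eq_sum_range r
  rw [hr.eq_zero, Finset.sum_range_succ, hP.monic.coeff_natDegree, one_mul] at heval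
  have hmem : ∑ i ∈ Finset.range n, P.coeff i * r ^ i ∈ IsLocalRing.maximalIdeal ℤ_[p] := by
    refine Ideal.sum_mem _ (fun i hi => ?_)
    exact Ideal.mul_mem_right _ _ (hP.mem (Finset.mem_range.mp hi))
  have hrn : r ^ n ∈ IsLocalRing.maximalIdeal ℤ_[p] := by
    have : r ^ n = -(∑ i ∈ Finset.range n, P.coeff i * r ^ i) := by linear_combination -heval
    rw [this]
    exact neg_mem hmem
  have hrm : r ∈ IsLocalRing.maximalIdeal ℤ_[p] := Ideal.IsPrime.mem_of_pow_mem inferInstance n hrn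
  exact PadicInt.mem_nonunits.mp hrm

/-- **A root of the Weierstrass polynomial gives a linear factor in `Λ`**: `P(r) = 0`, `g = P·u` ⇒ `(T − r) ∣ g`. [cite: Washington1997, §7.1] -/
theorem coe_X_sub_C_dvd_of_isRoot {g u : PowerSeries ℤ_[p]} {P : ℤ_[p][X]} (H : g.IsWeierstrassFactorization P u) {r : ℤ_[p]}
    (hr : P.IsRoot r) : (X - C r : PowerSeries ℤ_[p]) ∣ g := by
  obtain ⟨Q, hQ⟩ := Polynomial.dvd_iff_isRoot.mpr hr
  refine ⟨(Q : PowerSeries ℤ_[p]) * u, ?_⟩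
  rw [H.eq_mul, hQ, Polynomial.coe_mul, Polynomial.coe_sub, Polynomial.coe_X, Polynomial.coe_C, mul_assoc]

/-! ## §3 Weierstrass degree `2` or `3`: prime ⟸ no root -/

/-- ★ **Weierstrass degree `2 ≤ deg P ≤ 3` and NO ROOT of `P` in `ℤ_p` ⇒ `g = P·u` is PRIME in `Λ`** (a monic polynomial of degree `2` or `3` over a domain
is irreducible iff it has no root; irreducible ⟺ prime in the UFD `ℤ_p[X]`; `…Prime` §1). [cite: Washington1997, §7.1 and §13.2] -/
theorem prime_of_isWeierstrassFactorization_of_forall_not_isRoot {g u : PowerSeries ℤ_[p]} {P : ℤ_[p][X]}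
    (H : g.IsWeierstrassFactorization P u) (h2 : 2 ≤ P.natDegree) (h3 : P.natDegree ≤ 3) (hroot : ∀ r : ℤ_[p], ¬ P.IsRoot r) :
    Prime g := by
  have hroots : P.roots = 0 :=
    Multiset.eq_zero_of_forall_notMem (fun r hr => hroot r ((Polynomial.mem_roots H.isDistinguishedAt.monic.ne_zero).mp hr))
  have hirr : Irreducible P := (H.isDistinguishedAt.monic.irreducible_iff_roots_eq_zero_of_degree_le_three h2 h3).mpr hroots
  exact prime_of_isWeierstrassFactorization H (UniqueFactorizationMonoid.irreducible_iff_prime.mp hirr)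

/-- ★★ **THE INTRINSIC NO-ROOT CRITERION.** `g ∈ ℤ_p⟦T⟧` with `g ≢ 0 (mod p)`, `2 ≤ λ(g) ≤ 3`, and NO linear factor `T − r` with `‖r‖ < 1` dividing `g`
⇒ `g` is PRIME in `Λ` (the Weierstrass polynomial has degree `λ(g)`, any root of it lies in `pℤ_p` and would give such a linear factor). For the `ι`-pair
factor `Q` (`λ = 2`) of the `a₂ = −1` road: `Prime Q` ⟺ the two valuation-one zeros of `L₂(W,T)` next to `−2` are NOT in `ℚ₂`.
[cite: Washington1997, §7.1 and §13.2] [cite: GreenbergLNM1716, §5 pp. 176–178] -/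
theorem prime_of_lam_le_three_of_forall_not_dvd {g : PowerSeries ℤ_[p]} (hg : g.map (IsLocalRing.residue ℤ_[p]) ≠ 0)
    (h2 : 2 ≤ lam g) (h3 : lam g ≤ 3) (hroot : ∀ r : ℤ_[p], ‖r‖ < 1 → ¬ ((X - C r : PowerSeries ℤ_[p]) ∣ g)) : Prime g := by
  have H := g.isWeierstrassFactorization_weierstrassDistinguished_weierstrassUnit hg
  have hdeg : (g.weierstrassDistinguished hg).natDegree = lam g := natDegree_eq_lam_of_isWeierstrassFactorization H
  refine prime_of_isWeierstrassFactorization_of_forall_not_isRoot H (by omega) (by omega) (fun r hr => ?_)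
  have hlt : ‖r‖ < 1 := norm_lt_one_of_isRoot_of_isDistinguishedAt H.isDistinguishedAt hr
  exact hroot r hlt (coe_X_sub_C_dvd_of_isRoot H hr)

/-- Conversely, **a prime `g` with `λ(g) ≥ 2` has no linear factor `T − r`, `‖r‖ < 1`** (such a factor is prime with `λ = 1`, so `g ~ T − r` would have
`λ(g) = 1`). [cite: Washington1997, §7.1] -/
theorem forall_not_dvd_of_prime_of_two_le_lam {g : PowerSeries ℤ_[p]} (hg : Prime g) (h2 : 2 ≤ lam g) :
    ∀ r : ℤ_[p], ‖r‖ < 1 → ¬ ((X - C r : PowerSeries ℤ_[p]) ∣ g) := by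
  intro r hr ⟨c, hc⟩
  have hL : Prime (X - C r : PowerSeries ℤ_[p]) := prime_X_sub_C_of_norm_lt_one hr
  -- `g = (T − r)·c` with `g` prime: `g ∣ (T − r)` or `g ∣ c`; the latter makes `T − r` a unit
  have hg0 : g ≠ 0 := hg.ne_zero
  have hc0 : c ≠ 0 := by rintro rfl; exact hg0 (by rw [hc, mul_zero])
  rcases hg.dvd_or_dvd (show g ∣ (X - C r) * c from ⟨1, by rw [mul_one, hc]⟩) with h1 | h1
  · -- `g ∣ T − r` and `T − r ∣ g`: associated, so `λ(g) = λ(T − r) = 1`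
    have hassoc : Associated g (X - C r) := associated_of_dvd_dvd h1 ⟨c, hc⟩
    obtain ⟨v, hv⟩ := hassoc
    have hlam : lam (X - C r : PowerSeries ℤ_[p]) = lam g := by
      rw [← hv, lam_mul hg0 v.isUnit.ne_zero, lam_eq_zero_of_isUnit v.isUnit, add_zero]
    -- `λ(T − r) = 1`: Weierstrass factorisation `(X − C r)·1`
    have hmem : r ∈ IsLocalRing.maximalIdeal ℤ_[p] := PadicInt.mem_nonunits.mpr hr
    have hdist : (Polynomial.X - Polynomial.C r : ℤ_[p][X]).IsDistinguishedAt (IsLocalRing.maximalIdeal ℤ_[p]) := by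
      refine ⟨⟨fun {n} hn => ?_⟩, Polynomial.monic_X_sub_C r⟩
      rw [Polynomial.natDegree_X_sub_C] at hn
      have hn0 : n = 0 := by omega
      subst hn0
      rw [Polynomial.coeff_sub, Polynomial.coeff_X_zero, Polynomial.coeff_C_zero, zero_sub]
      exact neg_mem hmem
    have HW : (X - C r : PowerSeries ℤ_[p]).IsWeierstrassFactorization (Polynomial.X - Polynomial.C r) 1 :=
      ⟨hdist, isUnit_one, by rw [mul_one, Polynomial.coe_sub, Polynomial.coe_X, Polynomial.coe_C]⟩
    have h1' : lam (X - C r : PowerSeries ℤ_[p]) = 1 := by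
      rw [← natDegree_eq_lam_of_isWeierstrassFactorization HW, Polynomial.natDegree_X_sub_C]
    omega
  · -- `g ∣ c`, `c = g·d`, so `g = (T − r)·g·d` and `T − r` is a unit — impossible
    obtain ⟨d, hd⟩ := h1
    have : g * 1 = g * ((X - C r) * d) := by
      calc g * 1 = g := mul_one g
        _ = (X - C r) * c := hc
        _ = (X - C r) * (g * d) := by rw [hd]
        _ = g * ((X - C r) * d) := by ring
    have hunit : IsUnit (X - C r : PowerSeries ℤ_[p]) := IsUnit.of_mul_eq_one d (mul_left_cancel₀ hg0 this).symm
    exact hL.not_unit hunit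

end Summit.BirchSwinnertonDyer.BirchSwinnertonDyer.Theorems.AlignedTransportAtTwoEisensteinRigidityPrimeLowDegree

end
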